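import Summits.HodgeConjecture.CorCM.Census.BlockParityLaw

/-!
# The block-parity law, VIII: base change of faces, and the counting engine for functionals invariant on the Hodge lattice only («divided parities»)

COR-CM (cell `pub-hodgecm2`), count-neutral kernel combinatorics by the binder seat b09 (gen 28; lane BLOCK-PARITY-FLOOR),
part VIII, sequel of `Census/BlockParityLaw.lean` (I) only.  Theorems only; no certificate, no named fact, no `sorry`.
HONEST FRAMING: `HC_CM` is NOT proved; nothing here is a period or a headline.

WHY.  Part I's engine (`finrank_span_par_le_card`) bounds `|S|` for ANY family `S ⊆ ℤ[types]` with `faces ⊆ pairs + ℤ[G]·S` by a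
functional that is base-change invariant on ALL of `ℤ[types]` — the block parities are the universal such functional, and parts
II–III show they give exactly `β − 1 − δ`.  André-3's atlas (PORTFOLIO-g15 §0 (D)) counts families of HODGE vectors, and there the
binding invariant is `fibre₂ = dim_𝔽₂ Λ/(I_G Λ + 2Λ)` (`Λ` = Hodge lattice mod pairs), which exceeds `β − 1 − δ` on some `2`-groups
(`Q₈: 2 > 0`, `Q₁₆: 16 > 14`, `ℤ/4×ℤ/2, c ∈ 2G: 2 > 1`, …): the extra conditions are functionals invariant on the Hodge lattice only
(«divided parities»), which do not extend invariantly to `ℤ[types]`.  This file supplies the engine for them.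

CONTENT (`G` finite, `c ∈ G` with `c² = 1`).
* §1 **Base change of faces**: `(gface Φ t t')·Q⁻¹ = gface (Φ·Q⁻¹) (tQ⁻¹) (t'Q⁻¹)` (`mapDomain_rt_gface`), so the face lattice
  `span ℤ gfaceSet` is base-change stable (`mapDomain_rt_mem_span_gfaceSet`); for central `c` so is the lattice of pairs
  (`mapDomain_rt_pair`).
* §2 **Engine for functionals invariant on a submodule** (`span_le_of_invariantOn`, `finrank_span_le_card_of_invariantOn`): if
  `φ : ℤ[types] →ₗ[ℤ] M` (`M` an `𝔽₂`-space) kills `P₀` and satisfies `φ(x·Q⁻¹) = φ(x)` for the members `x` of a set `N ⊇ S` only,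
  and `X ⊆ P₀ + ℤ[G]·S`, then `span_𝔽₂ φ(X) ≤ span_𝔽₂ φ(S)` and `dim_𝔽₂ span φ(X) ≤ |S|`.  With `N` = the Hodge lattice
  (faces + pairs, stable by §1), `X` = the faces and `φ` a divided parity: **every family of HODGE vectors whose base changes
  generate the faces modulo pairs has at least `dim_𝔽₂ span φ(faces)` members** — the kernel form of the lower half `μ ≥ fibre₂` of
  André-3's law, one functional at a time (part I's `par` is the case `N = ℤ[types]`).

## References
* [Pohlmann1968] H. Pohlmann, Algebraic cycles on abelian varieties of complex multiplication type, Ann. of Math. 88 (1968), Thm 1.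
* [Milne1999] J. S. Milne, Lefschetz motives and the Tate conjecture, Compositio Math. 117 (1999), Prop. 2.1, p. 54.
-/

namespace Summit.HodgeConjecture.CorCM.Census.BlockParity

open Finset
open Summit.HodgeConjecture.CorCM.Prior.AllgGroup.RfwfAllgGroup

noncomputable section

variable {G : Type*} [Group G] [Fintype G] [DecidableEq G] (c : G)

/-! ## §1 Base change of faces and pairs -/

/-- **Base change of a face is a face**: `(gface Φ t t')·Q⁻¹ = gface (Φ·Q⁻¹) (tQ⁻¹) (t'Q⁻¹)`. [folklore] -/
theorem mapDomain_rt_gface (hc2 : c * c = 1) (Q : G) (Φ : CMF G c) (t t' : G) :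
    Finsupp.mapDomain (rt c Q) (gface c hc2 Φ t t') = gface c hc2 (rt c Q Φ) (t * Q⁻¹) (t' * Q⁻¹) := by
  unfold gface
  simp only [Finsupp.mapDomain_add, Finsupp.mapDomain_sub, Finsupp.mapDomain_single, rt_oflipCM]

omit [Fintype G] in
/-- Distinct places stay distinct under base change. [folklore] -/
theorem notMem_orb_mul_inv (Q : G) {t t' : G} (ht' : t' ∉ orb c t) : t' * Q⁻¹ ∉ orb c (t * Q⁻¹) := by
  rw [← mul_mem_orb_iff, inv_mul_cancel_right]
  exact ht'

/-- **The face lattice is base-change stable.** [folklore] -/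
theorem mapDomain_rt_mem_span_gfaceSet (hc2 : c * c = 1) (Q : G) {x : CMF G c →₀ ℤ}
    (hx : x ∈ Submodule.span ℤ (gfaceSet G c hc2)) :
    Finsupp.mapDomain (rt c Q) x ∈ Submodule.span ℤ (gfaceSet G c hc2) := by
  have h : Submodule.map (Finsupp.lmapDomain ℤ ℤ (rt c Q)) (Submodule.span ℤ (gfaceSet G c hc2)) ≤
      Submodule.span ℤ (gfaceSet G c hc2) := by
    rw [Submodule.map_span, Submodule.span_le]
    rintro _ ⟨y, ⟨Φ, t, t', ht', rfl⟩, rfl⟩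
    rw [Finsupp.lmapDomain_apply, mapDomain_rt_gface]
    exact Submodule.subset_span ⟨_, _, _, notMem_orb_mul_inv c Q ht', rfl⟩
  exact h (Submodule.mem_map_of_mem hx)

/-- For central `c`, **the base change of a pair is a pair**: `([Ψ] + [Ψ̄])·Q⁻¹ = [Ψ·Q⁻¹] + [Ψ·Q⁻¹‾]`. [folklore] -/
theorem mapDomain_rt_pair (hcen : ∀ x : G, x * c = c * x) (Q : G) (Ψ : CMF G c) :
    Finsupp.mapDomain (rt c Q) (Finsupp.single Ψ 1 + Finsupp.single (rt c c Ψ) 1) =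
      Finsupp.single (rt c Q Ψ) 1 + Finsupp.single (rt c c (rt c Q Ψ)) 1 := by
  rw [Finsupp.mapDomain_add, Finsupp.mapDomain_single, Finsupp.mapDomain_single, ← rt_mul, ← rt_mul, hcen Q]

/-! ## §2 The counting engine for functionals invariant on a submodule -/

section Engine

variable {M : Type*} [AddCommGroup M] [Module (ZMod 2) M]

/-- **Engine, span form, invariance on `N ⊇ S` only.**  If `φ` kills `P₀`, `φ(s·Q⁻¹) = φ(s)` for `s ∈ N ⊇ S`, and
`X ⊆ P₀ + ℤ[G]·S`, then `span_𝔽₂ φ(X) ≤ span_𝔽₂ φ(S)`. [folklore] -/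
theorem span_le_of_invariantOn (φ : (CMF G c →₀ ℤ) →ₗ[ℤ] M) (N : Set (CMF G c →₀ ℤ)) (P₀ : Submodule ℤ (CMF G c →₀ ℤ))
    (S : Finset (CMF G c →₀ ℤ)) (hS : (S : Set (CMF G c →₀ ℤ)) ⊆ N)
    (hφ : ∀ (Q : G), ∀ x ∈ N, φ (Finsupp.mapDomain (rt c Q) x) = φ x) (hP₀ : ∀ y ∈ P₀, φ y = 0)
    {X : Set (CMF G c →₀ ℤ)} (hX : X ⊆ ↑(P₀ ⊔ Submodule.span ℤ (translates c S))) :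
    Submodule.span (ZMod 2) (φ '' X) ≤ Submodule.span (ZMod 2) (φ '' (S : Set (CMF G c →₀ ℤ))) := by
  rw [Submodule.span_le]
  rintro _ ⟨x, hx, rfl⟩
  obtain ⟨p, hp, z, hz, hpz⟩ := Submodule.mem_sup.mp (hX hx)
  rw [← hpz, map_add, hP₀ p hp, zero_add]
  have hz' : φ z ∈ Submodule.span ℤ (φ '' (S : Set (CMF G c →₀ ℤ))) := by
    have hmap : Submodule.map φ (Submodule.span ℤ (translates c S)) ≤ Submodule.span ℤ (φ '' (S : Set (CMF G c →₀ ℤ))) := by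
      rw [Submodule.map_span, Submodule.span_le]
      rintro _ ⟨y, ⟨Q, s, hs, rfl⟩, rfl⟩
      rw [hφ Q s (hS hs)]
      exact Submodule.subset_span ⟨s, hs, rfl⟩
    exact hmap (Submodule.mem_map_of_mem hz)
  exact (Submodule.span_le_restrictScalars (R := ℤ) (S := ZMod 2) (s := φ '' (S : Set (CMF G c →₀ ℤ)))) hz'

/-- **Engine, counting form, invariance on `N ⊇ S` only**: `dim_𝔽₂ span φ(X) ≤ |S|`.  With `N` the (base-change stable) Hodge
lattice, `X` the faces and `φ` any `𝔽₂`-valued functional killing the pairs and invariant on `N` («divided parity»): every family of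
Hodge vectors whose base changes generate the faces modulo pairs has at least `dim_𝔽₂ span φ(faces)` members. [folklore] -/
theorem finrank_span_le_card_of_invariantOn (φ : (CMF G c →₀ ℤ) →ₗ[ℤ] M) (N : Set (CMF G c →₀ ℤ))
    (P₀ : Submodule ℤ (CMF G c →₀ ℤ)) (S : Finset (CMF G c →₀ ℤ)) (hS : (S : Set (CMF G c →₀ ℤ)) ⊆ N)
    (hφ : ∀ (Q : G), ∀ x ∈ N, φ (Finsupp.mapDomain (rt c Q) x) = φ x) (hP₀ : ∀ y ∈ P₀, φ y = 0)
    {X : Set (CMF G c →₀ ℤ)} (hX : X ⊆ ↑(P₀ ⊔ Submodule.span ℤ (translates c S))) :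
    Module.finrank (ZMod 2) (Submodule.span (ZMod 2) (φ '' X)) ≤ S.card := by
  classical
  haveI : Module.Finite (ZMod 2) (Submodule.span (ZMod 2) (φ '' (S : Set (CMF G c →₀ ℤ)))) :=
    Module.Finite.span_of_finite (ZMod 2) (S.finite_toSet.image φ)
  refine (Submodule.finrank_mono (span_le_of_invariantOn c φ N P₀ S hS hφ hP₀ hX)).trans ?_
  rw [← Finset.coe_image]
  exact (finrank_span_finset_le_card (S.image φ)).trans Finset.card_image_le

/-- Part I's block parities are the case `N = ℤ[types]`: the engine for `par` recovered. [folklore] -/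
theorem finrank_span_par_le_card' (S : Finset (CMF G c →₀ ℤ)) (P₀ : Submodule ℤ (CMF G c →₀ ℤ))
    (hP₀ : ∀ y ∈ P₀, par c y = 0) {X : Set (CMF G c →₀ ℤ)} (hX : X ⊆ ↑(P₀ ⊔ Submodule.span ℤ (translates c S))) :
    Module.finrank (ZMod 2) (Submodule.span (ZMod 2) (par c '' X)) ≤ S.card :=
  finrank_span_le_card_of_invariantOn c (par c) Set.univ P₀ S (Set.subset_univ _) (fun Q x _ => par_mapDomain_rt c Q x) hP₀ hX

end Engine

end

end Summit.HodgeConjecture.CorCM.Census.BlockParity
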